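import Summits.QuantumFields.YangMills.Theorems.BalabanUVNodesN11RunGuardInThm2Regime
import Summits.QuantumFields.YangMills.Theorems.BalabanUVNodesK1V7RDefs
import Literature.MathematicalPhysics.QuantumFieldTheory.Balaban1983to89.Node00.Record13SepCoPHV
import Summits.QuantumFields.YangMills.Theses.BalabanUVNodes

/-!
# DAG node N11 × K1⁹ — THE REGISTERED «v8» STUB TEXTS MEET THE RUN GUARD: every supplier of `stub_runRows13PWS` ∕ `stub_cont13`, and any proof of the deciding crux
# `StabilityBRunRowsAtRecordR13SepCoPHV`, delivers its rows at a record whose every small window contains partition-INCOMPATIBLE runs of every length; on the runs of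
# [I] Thm 2's regime the guard is ONE world scalar

HEADER — WORK-UNIT METADATA.  Cell `pub-ymgap`, YM-PLAN Track A (HUMAN RULING D-0062 ∕ D-0149 width seats), seat `pub-ymgap-dag-n11-w4` (g4; WIDTH SEAT 4 of 4 on NODE n11
[B14]), route `BalabanUVNodes` rev 28∕29 (KEY MAP v2 of record, dag-lead GATE v1.69: K1⁹ `StabilityBRunRowsAtRecordR13SepCoPHV` = stmt-QuantumFields-27364 is THE DECIDING ∃-side crux;
K1⁸ 26907 ∕ K1⁷ 20542 aside), helper lane (`--kind proof --supports stmt-QuantumFields-27364 --as helper`, count-neutral); dag-lead g17 DEDUP-392 (4b) «n11-w4 take x3».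
[I] = [Balaban1987RG1], [III] = [Balaban1988Convergent], [V] = [Balaban1989LargeFieldII].  Over this seat's p615408 `…N11RunGuardIsCouplingFloor` (`window_genSeq_of_betaLe`,
`exists_window_not_partCompat₁₃_of_betaLe`, `betaLe_of_runConstRemainder`), p620293 `…N11RunGuardInThm2Regime` (`partCompat₁₃_of_discrete031_of_floor`; imported — it carries p615408), the
tree twins of the registered K1 skeleton «v8ʳᵉᶠˡ» stub TEXTS BY NAME (`K1V6Defs.{RecordS, Inhabited13, NodesAtSomeRecord13PWS, RunRowsAtSomeRecord13PWS}`, `K1V7RDefs.RunRowsContAtSomeRecord13PWS` — v8's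
three stubs are byte-identical to v7ᴿ∕v6), and DEF-1's version-slot record `Node00/Record13SepCoPHV` (`Revision₁₃`, `datumOfRecord₁₃SepCoPHV`, flow∕β `rfl`-slot-free), and the route
file (the crux decl BY NAME, as a HYPOTHESIS; imported DIRECTLY — this file is a cone tip, nothing should import it; p621363 `…N11K1RunRowsConsequentMeetsIncompatibleRuns` is its K1⁸ twin).

WHY THIS FILE.  K1 «v8» (registered 2026-08-28 10:10Z on stmt-QuantumFields-27364) composes K1⁹ from three stubs: `stub_nodes13PWS : ∀ F, Inhabited13 F → NodesAtSomeRecord13PWS F`,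
`stub_runRows13PWS : ∀ F, NodesAtSomeRecord13PWS F → RunRowsAtSomeRecord13PWS F`, `stub_cont13 : ∀ F, RunRowsAtSomeRecord13PWS F → RunRowsContAtSomeRecord13PWS F`.  The rung-2″ TEXT
`RunRowsAtSomeRecord13PWS F` carries, at its witness `(θ, h, w)`, DEF-1's RUN-WISE CONSTANT REMAINDER `RunConstRemainder β_θ b r γ₀` — which IS the run-wise β-ceiling this seat's p615408 ∕
p621363 showed to be incompatible with the ∀-window run guard `PartCompat₁₃` of N11's no-expansion 𝐓-step (K0's proviso row `bg` is guarded by it).  This file keys that located fact BY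
NAME to the registered texts and to the crux: (§1) at the witness of the rung-2″ ∕ rung-3 text (whenever `1 ≤ θ.ν.r`; `M = L^a` is now the proviso row `Provisos₁₃SepCoPH.hM`, so it is
DISCHARGED), every window `γ ≤ γ₀` contains, for every length `K ≥ 1` and every `m`, a run of the record that is NOT `PartCompat₁₃` at `K` — its top 𝐃_K-cube does not fit 𝕋 (p623573
`partCompat₁₃_top_iff_mul_dvd_physicalTorus`); (§2) at the texts' world class `RecordS F θ h w`, on every run in [I] Thm 2's regime the guard holds at all levels from ONE world scalar
`log(1∕w.gR² + w.βup) ≤ L^{m−a}` (p620293 re-keyed from the CoPH to the SepCoPH record the texts read); (§3) K1⁹ BY NAME ⟹ at its witness `(θ, h, v)`: admissible, (B) at the SLOT datum,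
and (if `1 ≤ θ.ν.r`) in-window incompatible runs of every length along which the slot datum's `Sect2Form` holds — p621363 §3 through DEF-1's door, slot-invariant.  So the K1⁹ lane
inherits the guard obstruction verbatim: whatever supplies stub 2″ must supply N11's step where row `bg` idles — the BG-ONEBLOCK supply (chain 1: this seat's p624439 §1–§2; chain 2:
dag-n11-w5) is on the K1⁹ line too; `r = 0` is the idle case (p617030 `partCompat₁₃_of_r_eq_zero`).  LOCATED, count-neutral; no stub of v8 is proved or claimed here.

WHAT THIS FILE PROVES (0 `sorry`, 0 `def`).  §1 `incompatibleRuns_of_runConstRemainder` (generic `θ : Stage13Params F N`, `M = L^a`, `1 ≤ r`: DEF-1's `RunConstRemainder β_θ b r γ₀` + `∀ k, b k ≤ B` ⟹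
∀ γ ∈ ]0, γ₀], ∀ K ≥ 1, ∀ m, ∃ g₀: in-window run ∧ ¬`PartCompat₁₃ θ ⟨K,m,g₀⟩ K`) · ★★★ `incompatibleRuns_of_runRowsAtSomeRecord13PWS` (stub-2″'s CONCLUSION ∕ stub-3's ANTECEDENT ⟹ its own
body ∧ the incompatible-runs clause at the same `γ₀`) · `incompatibleRuns_of_runRowsContAtSomeRecord13PWS` (stub-3's CONCLUSION) · `incompatibleRuns_of_stubTexts3` (the three registered
stub statements as HYPOTHESES + `Inhabited13 F`).  §2 ★★ `partCompat₁₃_of_recordS_of_thm2Regime`.  §3 ★★★ `incompatibleRuns_of_stabilityBRunRowsAtRecordR13SepCoPHV` (the DECIDING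
CRUX BY NAME as hypothesis).

HONEST FRAMING.  Helper lane of K1⁹; count-neutral; the crux and the three stub statements are HYPOTHESES here, NOT proved, NOT refuted; nothing of [I]∕[III]∕[V] asserted.  N11 NOT
discharged; K1⁹∕K1⁸∕K1⁷ NOT closed; counts unmoved (typed 28∕28 · discharged 5∕27).  R4 closes only the conditional finite-𝕋⁴ rung `BalabanLadder.UV` of one programme at fixed
`ε = L^{−K}` — NOT ℝ⁴, NOT OS, NOT a mass gap, NOT Clay.  No `sorry`, `axiom`, `def`, `instance`, `notation`.  Sources (SHAPE ∕ bookkeeping only): [V] Thm 1 p.355; [III] (2.1)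
p.254, (2.5) p.255, p.257, Thm 1 p.262, Cor 3 p.264; [I] (0.18)–(0.20) pp.255–256, Thm 2 + (0.31) p.259, Thm 3 + (1.20)–(1.22) p.264, (5.10) p.293.
-/

noncomputable section

open scoped BigOperators

namespace Summit.QuantumFields.YangMills.Theorems.BalabanUVNodesN11K1V8StubTextsMeetRunGuard

open Literature.MathematicalPhysics.QuantumFieldTheory.Balaban1983to89 T4Continuum Node00 DagBinding
open FlowStep (HBeta RGEqH prefixOf)
open FlowStepRuns (genSeq solveCoupling solveCoupling_pos inv_sq_solveCoupling)
open BalabanUVNodesK2NamedJetsRunRemAt (RunConstRemainder)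
open K1V6Defs (RecordS Inhabited13 NodesAtSomeRecord13PWS RunRowsAtSomeRecord13PWS)
open K1V7RDefs (RunRowsContAtSomeRecord13PWS runRowsAtSomeRecord13PWS_of_runRowsContAtSomeRecord13PWS)
open BalabanUVNodesN11PartCompatOfCouplings (log_pow_le_of_partCompat₁₃)
open BalabanUVNodesN11RunGuardIsCouplingFloor (window_genSeq_of_betaLe exists_window_not_partCompat₁₃_of_betaLe betaLe_of_runConstRemainder)
open BalabanUVNodesN11RunGuardInThm2Regime (partCompat₁₃_of_discrete031_of_floor)

/-! ## §1  The rung-2″ ∕ rung-3 TEXTS of K1 «v8» at their witness: in-window incompatible runs of every length -/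

section Rows

variable {F : T4Family} {N : ℕ} [NeZero N]

/-- **DEF-1's RUN-WISE CONSTANT REMAINDER + A BOUNDED REFERENCE SEQUENCE ⇒ IN-WINDOW INCOMPATIBLE RUNS OF EVERY LENGTH** (generic `θ : Stage13Params F N` with `θ.τ9.M = F.L^a`,
`1 ≤ θ.ν.r`): rows (i) `RunConstRemainder β_θ b r γ₀` (`|β_k(g_0,…,g_k) − b_k| ≤ r`, `k ≤ n`, along every in-window (0.20)-run of horizon `n`) and (ii) `∀ k, b k ≤ B` of the rung-2″
text give the run-wise β-ceiling `B + r` (p615408 `betaLe_of_runConstRemainder`), hence for every `γ ∈ ]0, γ₀]`, every `K ≥ 1` and every `m` some bare coupling `g₀` generates a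
run `⟨K, m, g₀⟩` of the record lying in `]0, γ]` up to `K` which is NOT `PartCompat₁₃` at `K` (p615408 `exists_window_not_partCompat₁₃_of_betaLe`).
[cite: Balaban1987RG1, Thm 3 + (1.20)–(1.22) p.264, (0.20) p.256; Balaban1988Convergent, (2.1) p.254, (2.5) p.255, p.257] -/
theorem incompatibleRuns_of_runConstRemainder (θ : Stage13Params F N) {a : ℕ} (hM : θ.τ9.M = F.L ^ a) (hr : 1 ≤ θ.ν.r)
    {b : ℕ → ℝ} {r γ₀ B : ℝ} (hrem : RunConstRemainder (betaOfRecord₁₃ F N θ) b r γ₀) (hb : ∀ k, b k ≤ B)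
    {γ : ℝ} (hγ : 0 < γ) (hγ₀ : γ ≤ γ₀) {K : ℕ} (hK : 1 ≤ K) (m : ℕ) :
    ∃ g0 : ℝ, Step.InInterval γ K (gOfRecord₁₃ F N θ ⟨K, m, g0⟩) ∧ ¬ PartCompat₁₃ F N θ ⟨K, m, g0⟩ K :=
  exists_window_not_partCompat₁₃_of_betaLe θ hM hr (betaLe_of_runConstRemainder hrem hb) hγ hγ₀ hK m

/-- **★★★ THE RUNG-2″ TEXT `K1V6Defs.RunRowsAtSomeRecord13PWS F` (= the CONCLUSION of the registered stub `stub_runRows13PWS` = the ANTECEDENT of `stub_cont13`, v8ʳᵉᶠˡ = v7ᴿ = v6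
VERBATIM) MEETS THE RUN GUARD**: its witness `(θ, h, w)` carries the text's own body — unity ∕ slots, admissibility, the S-bound record class `RecordS`, the thirteen DAG nodes at
every run, and the run rows `(b, r, γ₀, B, M)` — AND, whenever `1 ≤ θ.ν.r` (`θ.τ9.M = F.L^a` is the proviso row `Provisos₁₃SepCoPH.hM`), for every window `γ ∈ ]0, γ₀]`, every
length `K ≥ 1` and every `m`, a run of the record in `]0, γ]` that is NOT `PartCompat₁₃` at `K`.  LOCATED, count-neutral: the text is a HYPOTHESIS.
[cite: Balaban1987RG1, Thm 3 + (1.20)–(1.22) p.264, (5.10) p.293; Balaban1988Convergent, (2.5) p.255, p.257; Balaban1989LargeFieldII, Thm 1 p.355] -/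
theorem incompatibleRuns_of_runRowsAtSomeRecord13PWS {F : T4Family} (hrows : RunRowsAtSomeRecord13PWS F) :
    ∃ (θ : Stage13HParams F 2) (h : θ.Provisos₁₃SepCoPH F 2) (w : WorldP), (θ.ZhUnity F 2 ∧ θ.SlotsNondegenerate₁₃ F 2) ∧ θ.Admissible F 2 ∧
      RecordS F θ h w ∧ (∀ P : B12.RunParams, Nodes (leavesP w P)) ∧
      ∃ (b : ℕ → ℝ) (r γ₀ B M : ℝ), 0 < γ₀ ∧ RunConstRemainder (betaOfRecord₁₃ F 2 θ.toStage13Params) b r γ₀ ∧ (∀ k, b k ≤ B) ∧ B + r ≤ w.βup ∧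
        (∀ (n : ℕ) (gs : ℕ → ℝ), RGEqH n (betaOfRecord₁₃ F 2 θ.toStage13Params) gs → Step.InInterval γ₀ n gs →
          ∀ k, k ≤ n → -M ≤ ∑ j ∈ Finset.Ico k n, betaOfRecord₁₃ F 2 θ.toStage13Params j (prefixOf gs j)) ∧
        (1 ≤ θ.ν.r → ∀ γ : ℝ, 0 < γ → γ ≤ γ₀ → ∀ K : ℕ, 1 ≤ K → ∀ m : ℕ, ∃ g0 : ℝ,
          Step.InInterval γ K (gOfRecord₁₃ F 2 θ.toStage13Params ⟨K, m, g0⟩) ∧ ¬ PartCompat₁₃ F 2 θ.toStage13Params ⟨K, m, g0⟩ K) := by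
  obtain ⟨θ, h, w, hUS, hA, hR, hN, b, r, γ₀, B, M, hγ₀, hrem, hb, hB, hPS⟩ := hrows
  obtain ⟨a, hMa⟩ := h.hM
  exact ⟨θ, h, w, hUS, hA, hR, hN, b, r, γ₀, B, M, hγ₀, hrem, hb, hB, hPS, fun hr γ hγ hγle K hK m =>
    incompatibleRuns_of_runConstRemainder θ.toStage13Params hMa hr hrem hb hγ hγle hK m⟩

/-- **THE RUNG-3 TEXT `K1V7RDefs.RunRowsContAtSomeRecord13PWS F` (= the CONCLUSION of the registered stub `stub_cont13`) MEETS THE RUN GUARD** — through `K1V7RDefs`' bridge to the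
rung-2″ text (the run-wise survivor continuity (C) is not read).  LOCATED, count-neutral: the text is a HYPOTHESIS.
[cite: Balaban1987RG1, Thm 3 + (1.20)–(1.22) p.264, §1 pp.263–264; Balaban1988Convergent, (2.5) p.255, p.257] -/
theorem incompatibleRuns_of_runRowsContAtSomeRecord13PWS {F : T4Family} (hrows : RunRowsContAtSomeRecord13PWS F) :
    ∃ (θ : Stage13HParams F 2) (h : θ.Provisos₁₃SepCoPH F 2) (w : WorldP), (θ.ZhUnity F 2 ∧ θ.SlotsNondegenerate₁₃ F 2) ∧ θ.Admissible F 2 ∧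
      RecordS F θ h w ∧ (∀ P : B12.RunParams, Nodes (leavesP w P)) ∧
      ∃ (b : ℕ → ℝ) (r γ₀ B M : ℝ), 0 < γ₀ ∧ RunConstRemainder (betaOfRecord₁₃ F 2 θ.toStage13Params) b r γ₀ ∧ (∀ k, b k ≤ B) ∧ B + r ≤ w.βup ∧
        (∀ (n : ℕ) (gs : ℕ → ℝ), RGEqH n (betaOfRecord₁₃ F 2 θ.toStage13Params) gs → Step.InInterval γ₀ n gs →
          ∀ k, k ≤ n → -M ≤ ∑ j ∈ Finset.Ico k n, betaOfRecord₁₃ F 2 θ.toStage13Params j (prefixOf gs j)) ∧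
        (1 ≤ θ.ν.r → ∀ γ : ℝ, 0 < γ → γ ≤ γ₀ → ∀ K : ℕ, 1 ≤ K → ∀ m : ℕ, ∃ g0 : ℝ,
          Step.InInterval γ K (gOfRecord₁₃ F 2 θ.toStage13Params ⟨K, m, g0⟩) ∧ ¬ PartCompat₁₃ F 2 θ.toStage13Params ⟨K, m, g0⟩ K) :=
  incompatibleRuns_of_runRowsAtSomeRecord13PWS (runRowsAtSomeRecord13PWS_of_runRowsContAtSomeRecord13PWS F hrows)

/-- **THE THREE REGISTERED STUB STATEMENTS OF K1 «v8» AS HYPOTHESES ⇒ at every inhabited family the rung-3 witness has in-window incompatible runs of every length** (whenever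
`1 ≤ θ.ν.r`) — whatever proves the stubs.  LOCATED, count-neutral: no stub is proved or claimed here.
[cite: Balaban1989LargeFieldII, Thm 1 p.355; Balaban1987RG1, Thm 3 p.264; Balaban1988Convergent, (2.5) p.255, p.257] -/
theorem incompatibleRuns_of_stubTexts3
    (h₁ : ∀ F : T4Family, Inhabited13 F → NodesAtSomeRecord13PWS F) (h₂ : ∀ F : T4Family, NodesAtSomeRecord13PWS F → RunRowsAtSomeRecord13PWS F)
    (h₃ : ∀ F : T4Family, RunRowsAtSomeRecord13PWS F → RunRowsContAtSomeRecord13PWS F) (F : T4Family) (hF : Inhabited13 F) :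
    ∃ (θ : Stage13HParams F 2) (h : θ.Provisos₁₃SepCoPH F 2) (w : WorldP), (θ.ZhUnity F 2 ∧ θ.SlotsNondegenerate₁₃ F 2) ∧ θ.Admissible F 2 ∧
      RecordS F θ h w ∧ (∀ P : B12.RunParams, Nodes (leavesP w P)) ∧
      ∃ (b : ℕ → ℝ) (r γ₀ B M : ℝ), 0 < γ₀ ∧ RunConstRemainder (betaOfRecord₁₃ F 2 θ.toStage13Params) b r γ₀ ∧ (∀ k, b k ≤ B) ∧ B + r ≤ w.βup ∧
        (∀ (n : ℕ) (gs : ℕ → ℝ), RGEqH n (betaOfRecord₁₃ F 2 θ.toStage13Params) gs → Step.InInterval γ₀ n gs →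
          ∀ k, k ≤ n → -M ≤ ∑ j ∈ Finset.Ico k n, betaOfRecord₁₃ F 2 θ.toStage13Params j (prefixOf gs j)) ∧
        (1 ≤ θ.ν.r → ∀ γ : ℝ, 0 < γ → γ ≤ γ₀ → ∀ K : ℕ, 1 ≤ K → ∀ m : ℕ, ∃ g0 : ℝ,
          Step.InInterval γ K (gOfRecord₁₃ F 2 θ.toStage13Params ⟨K, m, g0⟩) ∧ ¬ PartCompat₁₃ F 2 θ.toStage13Params ⟨K, m, g0⟩ K) :=
  incompatibleRuns_of_runRowsContAtSomeRecord13PWS (h₃ F (h₂ F (h₁ F hF)))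

end Rows

/-! ## §2  At the texts' world class `RecordS`: the guard on the runs of [I] Thm 2's regime is ONE world scalar -/

section World

variable {F : T4Family} {θ : Stage13HParams F 2}

/-- **★★ THE RUN GUARD IN [I] THM 2's REGIME AT THE TEXTS' WORLD CLASS** (`K1V6Defs.RecordS F θ h w`: the world is bound to the SepCoPH datum of `θ`, `w.C = datum.C`; `M = L^a`,
`r = 1`, `a ≤ m`, `0 < w.gR`, `0 ≤ w.βup`): the leaves `rgFlow`, `betaSmoothBounded`, `betaPositive`, `thm2Regime` at `P` (`DagBinding.thm2OfBeta_leavesP` ⇒ `smallCouplings ∧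
running`, and `running` IS the discrete (0.31) w.r.t. `w.gR`) and the world scalar `log(1∕w.gR² + w.βup) ≤ L^{m−a}` give `PartCompat₁₃ θ P n` for every `n ≤ P.K` — p620293's
CoPH theorem at the SepCoPH record the v8 texts read.  So on Theorem-2-regime runs the guard of the no-expansion 𝐓-step ∕ of K0's row `bg` is one scalar per world.
[cite: Balaban1987RG1, Thm 2 + (0.31) p.259, (0.20) p.256; Balaban1988Convergent, (2.1) p.254, (2.5) p.255, p.257; Balaban1989LargeFieldII, Thm 1 + (0.1) pp.355–356] -/
theorem partCompat₁₃_of_recordS_of_thm2Regime (h : θ.Provisos₁₃SepCoPH F 2) {w : WorldP} (hR : RecordS F θ h w)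
    {a : ℕ} (hM : θ.τ9.M = F.L ^ a) (hr : θ.ν.r = 1) (ha : a ≤ F.m) (hgR : 0 < w.gR) (hβ : 0 ≤ w.βup)
    (hfloor : Real.log (1 / w.gR ^ 2 + w.βup) ≤ ((F.L ^ (F.m - a) : ℕ) : ℝ))
    (P : B12.RunParams) (hrg : (leavesP w P).rgFlow) (hsb : (leavesP w P).betaSmoothBounded) (hbp : (leavesP w P).betaPositive)
    (hreg : (leavesP w P).thm2Regime) {n : ℕ} (hn : n ≤ P.K) : PartCompat₁₃ F 2 θ.toStage13Params P n := by
  obtain ⟨-, -, -, -, hC, -⟩ := hR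
  obtain ⟨hsc, hrun⟩ := thm2OfBeta_leavesP w P hrg hsb hbp hreg
  have hD : Step.Discrete031 w.b w.βup P.K w.gR (w.C P).flow.g :=
    (h033LogRunning_iff_discrete031 w.L w.gR w.b w.βup w.one_lt_L (w.C P).flow P.K).1 hrun
  have hsc' : ∀ i, i ≤ P.K → 0 < (w.C P).flow.g i := fun i hi => (hsc i hi).1
  rw [hC] at hD hsc'
  exact partCompat₁₃_of_discrete031_of_floor θ.toStage13Params hM hr P ha hgR hβ (fun i hi => hsc' i hi) hD hfloor hn

end World

/-! ## §3  The DECIDING CRUX K1⁹ BY NAME, as a hypothesis -/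

section Crux

/-- An in-window generated history solves (0.20) up to its horizon (local copy; `Node00.inv_sq_genSeq_succ`). [cite: Balaban1987RG1, (0.18)–(0.20) pp.255–256] -/
private theorem rgEqH_genSeq_of_window {β : HBeta} {γ g0 : ℝ} {n : ℕ} (hW : Step.InInterval γ n (genSeq β g0)) : RGEqH n β (genSeq β g0) := by
  intro k hk
  have h := inv_sq_genSeq_succ β g0 (hW (k + 1) (Nat.succ_le_of_lt hk)).1
  rw [one_div, one_div, h]
  ring

/-- **★★★ WHAT ANY PROOF OF K1⁹ DELIVERS — AT THE SLOT DATUM, RUNS OF EVERY LENGTH** (the crux `Summit.QuantumFields.YangMills.Theses.BalabanUVNodes.StabilityBRunRowsAtRecordR13SepCoPHV`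
as HYPOTHESIS, type literally): for every family `F` with a unity Stage-13 tuple, the `(θ, h, v)` the crux produces is admissible, carries (B) `B16.EndStatementBPrinted` at the SLOT
datum `datumOfRecord₁₃SepCoPHV θ h v`, AND — whenever `1 ≤ θ.ν.r` (every witness of record has `r = 1`; `θ.τ9.M = F.L^a` is the proviso row `hM`) — for all windows `γ ≤ γ⋆ :=
min(γ₀, γ₂)` (`γ₀` the crux's row level, `γ₂` the printed window of `Thm1Printed`), ALL lengths `K ≥ 1` and all `m`, a run of the record in `]0, γ]` (the slot datum's couplings ARE
`gOfRecord₁₃ θ`: `flow_g_datumOfRecord₁₃SepCoPHV`, `rfl`) that is NOT `PartCompat₁₃` at `K`, along which the SLOT datum's `Sect2Form k` holds for every `k ≤ K`.  Only the crux's FIRST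
run row is read, and only below the length `K` (ceiling `Σ_{j<K} |b_j| + |r|`; p615408's construction `window_genSeq_of_betaLe`, as in p621363 §1).  LOCATED, count-neutral: the crux is a
HYPOTHESIS, neither proved nor refuted.
[cite: Balaban1989LargeFieldII, Thm 1 p.355; Balaban1988Convergent, Thm 1 p.262, Cor 3 p.264, (2.1) p.254, (2.5) p.255, p.257; Balaban1987RG1, (0.20) p.256, Thm 3 + (1.20)–(1.22) p.264] -/
theorem incompatibleRuns_of_stabilityBRunRowsAtRecordR13SepCoPHV (hK1 : Summit.QuantumFields.YangMills.Theses.BalabanUVNodes.StabilityBRunRowsAtRecordR13SepCoPHV)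
    (F : T4Family) (hinh : ∃ θ : Stage13HParams F 2, θ.Provisos₁₃SepCoPH F 2 ∧ (θ.ZhUnity F 2 ∧ θ.SlotsNondegenerate₁₃ F 2) ∧ θ.Admissible F 2) :
    ∃ (θ : Stage13HParams F 2) (h : θ.Provisos₁₃SepCoPH F 2) (v : Revision₁₃ F 2 θ h),
      θ.Admissible F 2 ∧ B16.EndStatementBPrinted (datumOfRecord₁₃SepCoPHV F 2 θ h v).C ∧
      (1 ≤ θ.ν.r → ∃ γs : ℝ, 0 < γs ∧ ∀ γ : ℝ, 0 < γ → γ ≤ γs → ∀ K : ℕ, 1 ≤ K → ∀ m : ℕ, ∃ g0 : ℝ,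
        Step.InInterval γ K (gOfRecord₁₃ F 2 θ.toStage13Params ⟨K, m, g0⟩) ∧ ¬ PartCompat₁₃ F 2 θ.toStage13Params ⟨K, m, g0⟩ K ∧
          ∀ k, k ≤ K → ((datumOfRecord₁₃SepCoPHV F 2 θ h v).C ⟨K, m, g0⟩).Sect2Form k) := by
  obtain ⟨θ, h, v, -, hA, hB, -, b, r, γ₀, M, hγ₀, hrem, -, -⟩ := hK1 F hinh
  obtain ⟨a, hMa⟩ := h.hM
  obtain ⟨γ₂, hγ₂, hS⟩ := hB.1
  refine ⟨θ, h, v, hA, hB, fun hr => ⟨min γ₀ γ₂, lt_min hγ₀ hγ₂, fun γ hγ hγle K hK m => ?_⟩⟩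
  have hγ₀' : γ ≤ γ₀ := hγle.trans (min_le_left _ _)
  -- the β-ceiling BELOW `K` from the crux's first run row
  set β := betaOfRecord₁₃ F 2 θ.toStage13Params with hβdef
  set B : ℝ := (∑ j ∈ Finset.range K, |b j|) + |r| with hBdef
  have hB0 : 0 ≤ B := by positivity
  have hBrow : ∀ n, n < K → ∀ gs : ℕ → ℝ, RGEqH n β gs → Step.InInterval γ₀ n gs → β n (prefixOf gs n) ≤ B := by
    intro n hn gs hrg hI
    have h1 := (abs_le.mp (hrem n gs hrg hI n le_rfl)).2
    have h2 : b n ≤ |b n| := le_abs_self _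
    have h3 : |b n| ≤ ∑ j ∈ Finset.range K, |b j| :=
      Finset.single_le_sum (f := fun j => |b j|) (fun j _ => abs_nonneg (b j)) (Finset.mem_range.mpr hn)
    have h4 : r ≤ |r| := le_abs_self _
    linarith
  -- p615408's bare coupling: tiny enough that the run stays in `]0, γ]` and `g_K` lies below the floor
  set T : ℝ := ((F.L ^ (F.m + K - K - a) : ℕ) : ℝ) with hTdef
  have hT0 : 0 ≤ T := by positivity
  set y : ℝ := 1 / γ ^ 2 + B * K + Real.exp (T + 1) with hydef
  have hγ2 : 0 < 1 / γ ^ 2 := by positivity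
  have hexp : 0 < Real.exp (T + 1) := Real.exp_pos _
  have hy : 0 < y := by positivity
  set g0 : ℝ := solveCoupling y with hg0def
  have hg0 : 0 < g0 := solveCoupling_pos hy
  have hg0y : 1 / g0 ^ 2 = y := inv_sq_solveCoupling hy
  have hBrun : ∀ k, k < K → Step.InInterval γ k (genSeq β g0) → β k (prefixOf (genSeq β g0) k) ≤ B := by
    intro k hk hWk
    have hWk₀ : Step.InInterval γ₀ k (genSeq β g0) := fun i hi => ⟨(hWk i hi).1, (hWk i hi).2.trans hγ₀'⟩
    exact hBrow k hk _ (rgEqH_genSeq_of_window hWk₀) hWk₀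
  have hsmall : 1 / γ ^ 2 + B * K ≤ 1 / g0 ^ 2 := by rw [hg0y]; linarith [hexp.le]
  obtain ⟨hW, hlow⟩ := window_genSeq_of_betaLe hγ hB0 hg0 hBrun hsmall
  have hnot : ¬ PartCompat₁₃ F 2 θ.toStage13Params ⟨K, m, g0⟩ K := by
    intro hPC
    have hKlow := hlow K le_rfl
    have hinv : Real.exp (T + 1) ≤ (genSeq β g0 K ^ 2)⁻¹ := by
      rw [← one_div]
      linarith
    have hlogK : T + 1 ≤ Real.log (genSeq β g0 K ^ 2)⁻¹ := by
      have h := Real.log_le_log hexp hinv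
      rwa [Real.log_exp] at h
    have hcap : (Real.log (genSeq β g0 K ^ 2)⁻¹) ^ θ.ν.r ≤ T :=
      (log_pow_le_of_partCompat₁₃ θ.toStage13Params hMa ⟨K, m, g0⟩ hPC hK le_rfl).2
    have hone : 1 ≤ Real.log (genSeq β g0 K ^ 2)⁻¹ := by linarith
    have hself : Real.log (genSeq β g0 K ^ 2)⁻¹ ≤ (Real.log (genSeq β g0 K ^ 2)⁻¹) ^ θ.ν.r :=
      le_self_pow₀ hone (by omega)
    linarith
  exact ⟨g0, hW, hnot, fun k hk => hS ⟨K, m, g0⟩ (fun j hj => ⟨(hW j hj).1, (hW j hj).2.trans (hγle.trans (min_le_right _ _))⟩) k hk⟩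

end Crux

end Summit.QuantumFields.YangMills.Theorems.BalabanUVNodesN11K1V8StubTextsMeetRunGuard

end
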